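import Mathlib
import Summits.SmoothPoincare4.SmoothPoincare4.Theorems.CylinderEntropyCylinderRungTwoKCertDefsBox
import HarnessLib

/-!
# Kernel certificate checker for `stub_certMid`, III-c: kernel-fast square roots and the fast replay

Infrastructure file for the kernel-clean discharge of the registered stub `stub_certMid` of crux stmt-SmoothPoincare4-7631
(`Summit.SmoothPoincare4.SmoothPoincare4.Theses.CylinderEntropy.CylinderRungTwo`, line `killing-flux`).  The validated square
roots of `…KCertDefs` start Newton's iteration from `2^(log₂ m / 2 + 1)`; `Nat.log2` is defined by well-founded recursion and
costs the kernel one unfolding per bit (measured: ≈ 60 ms per root on 130-bit radicands, the dominant cost of a leaf).  The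
arguments of the roots in the leaf test lie in `[0, 1]`, so `2^p` is a valid starting point; since the result is validated a
posteriori, soundness is unaffected by the starting point.  This file defines the fast roots `ksqrtLoF/ksqrtHiF` and the copies
`dEtBoxF`, `test1F`, `leafOKF`, `runF`, `runListF` of the replay chain that use them (the originals stay as they are); the
soundness files prove everything for the fast chain.
-/

-- the registered namespace `Summit.SmoothPoincare4.SmoothPoincare4.…` repeats a component
set_option linter.dupNamespace false

namespace Summit.SmoothPoincare4.SmoothPoincare4.Cruxes.CylinderRungTwo.KillingFlux

namespace KCert

open Summit.SmoothPoincare4.SmoothPoincare4.Theorems.CylinderEntropySliceIsolation.Cert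
open Literature.Analysis.ValidatedNumerics.NumericsMP (MI)

/-! ### Kernel-fast validated square roots (arguments in `[0, 1]`) -/

/-- Lower bound of `√x` to `p` bits, Newton started at `2^p`: `r/2^p` if `r² ≤ ⌊x 4^p⌋₊`, else `0`. [folklore] -/
def ksqrtLoF (x : ℚ) (p : ℕ) : ℚ :=
  let m := ⌊x * 4 ^ p⌋₊
  let r := isqrtF 200 m (2 ^ p)
  if r * r ≤ m then (r : ℚ) / 2 ^ p else 0

/-- Upper bound of `√x` to `p` bits, Newton started at `2^p`: `(r+1)/2^p` if `⌊x 4^p⌋₊ < (r+1)²`, else `max 1 x`. [folklore] -/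
def ksqrtHiF (x : ℚ) (p : ℕ) : ℚ :=
  let m := ⌊x * 4 ^ p⌋₊
  let r := isqrtF 200 m (2 ^ p) + 1
  if m < r * r then (r : ℚ) / 2 ^ p else max 1 x

/-! ### The fast replay chain -/

/-- Enclosure of `∂_θ E_T = -E_T · x · sin θ/(2T)` over the box, for `T` in the envelope range (fast square roots). [folklore] -/
def dEtBoxF (C : KCell) (B : BoxD) (E : ℚ × ℚ × ℚ × ℚ) : MI :=
  let Eiv : MI := ⟨zlo64 E.2.1, zhi64 E.1⟩
  let X : MI := ⟨B.U1.x.lo, B.U2.x.hi⟩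
  let invT : MI := ⟨zlo64 (1 / (2 * E.2.2.2)), zhi64 (1 / (2 * E.2.2.1))⟩
  let clq := toQ B.T2.cs.lo
  let chq := toQ B.T1.cs.hi
  let cmax2 := max (clq ^ 2) (chq ^ 2)
  let cmin2 : ℚ := if 0 ≤ clq then clq ^ 2 else if chq ≤ 0 then chq ^ 2 else 0
  let Sn : MI := ⟨zlo64 (ksqrtLoF (1 - cmax2) C.prec), zhi64 (ksqrtHiF (1 - cmin2) C.prec)⟩
  (MI.mul S64 (MI.mul S64 (MI.mul S64 Eiv X) Sn) invT).neg

/-- The second-order (corner) test of a box, given the atom enclosures `A` and the kernel quantities `E`: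
`hu · sup|∂_u(R - E)| + ht · sup|∂_θ(R - E)| ≤ min over corners of (R - E)` (scaled, outward rounded; fast square roots). [folklore] -/
def test1F (C : KCell) (B : BoxD) (A : ℤ × MI × MI) (E : ℚ × ℚ × ℚ × ℚ) : Bool :=
  let Gu := (A.2.1.sub (dEuBox B E)).absHi
  let Gt := (A.2.2.sub (dEtBoxF C B E)).absHi
  let hu := zhi64 ((B.U2.u - B.U1.u) / 2)
  let ht := zhi64 ((B.T2.t - B.T1.t) / 2)
  decide (0 ≤ hu) && decide (0 ≤ ht) && decide (0 < E.2.2.1) &&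
    decide (cdivZ (hu * Gu) S64 + cdivZ (ht * Gt) S64 ≤ dminBox C B)

/-- The leaf test of a box: zeroth-order test `sup E ≤ inf R`, else the second-order corner test (fast variant). [folklore] -/
def leafOKF (C : KCell) (tabs : List (List TabE)) (B : BoxD) : Bool :=
  let E := leafE C B
  let A := atomsBox B C.atoms tabs B.U1.glo B.U2.glo B.U1.ghi B.U2.ghi B.T1.tfl B.T2.tfl B.T1.hup
  decide (zhi64 E.1 ≤ zlo64 C.c + A.1) || test1F C B A E

/-- The script-driven bisection: consumes base-3 digits of `code` in preorder (`0` leaf, `1` split in `u`, `2` split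
in `θ`); returns the unconsumed part of the script on success (fast variant). [folklore] -/
def runF (C : KCell) (tabs : List (List TabE)) : ℕ → ℕ → BoxD → Option ℕ
  | 0, _, _ => none
  | fuel + 1, code, B =>
    match code % 3 with
    | 0 => if leafOKF C tabs B then some (code / 3) else none
    | 1 =>
      let um := (B.U1.u + B.U2.u) / 2
      let Um := mkUD C um
      let em1 := eCorner C Um B.T1
      let em2 := eCorner C Um B.T2
      match runF C tabs fuel (code / 3) ⟨B.U1, Um, B.T1, B.T2, B.e11, B.e12, em1, em2⟩ with
      | some code' => runF C tabs fuel code' ⟨Um, B.U2, B.T1, B.T2, em1, em2, B.e21, B.e22⟩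
      | none => none
    | _ =>
      let tm := (B.T1.t + B.T2.t) / 2
      let Tm := mkTDh C tabs tm B.T1.ia B.T2.ia B.T1.ib B.T2.ib
      let e1m := eCorner C B.U1 Tm
      let e2m := eCorner C B.U2 Tm
      match runF C tabs fuel (code / 3) ⟨B.U1, B.U2, B.T1, Tm, B.e11, e1m, B.e21, e2m⟩ with
      | some code' => runF C tabs fuel code' ⟨B.U1, B.U2, Tm, B.T2, e1m, B.e12, e2m, B.e22⟩
      | none => none

/-- Replay of a list of sub-box scripts `(k, l, fuel, code)` of the `KU × KT` partition (fast variant). [folklore] -/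
def runListF (C : KCell) (tabs : List (List TabE)) (KU KT : ℕ) (items : List (ℕ × ℕ × ℕ × ℕ)) : Bool :=
  items.all fun it => decide (runF C tabs it.2.2.1 it.2.2.2 (subBox C tabs KU KT it.1 it.2.1) = some 0)

end KCert

/-- Registered sub-goal marker `stub_certMid_part16` of crux stmt-SmoothPoincare4-7631 (helper file 3-c of the kernel-clean
`stub_certMid`, line killing-flux): the a-posteriori validation behind the fast square roots. [folklore] -/
theorem stub_certMid_part16 : ∀ r m : ℕ, r * r ≤ m → (r : ℝ) ≤ Real.sqrt m :=
  fun r m h => Real.le_sqrt_of_sq_le (by rw [sq]; exact_mod_cast h)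

end Summit.SmoothPoincare4.SmoothPoincare4.Cruxes.CylinderRungTwo.KillingFlux
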